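import Mathlib
import HarnessLib

/-!
# The transverse pinch — growth and coefficient lemmas (crux `PencilRigidity.ShellRigidity`,
line `thales-slit-exact-cone-type`, stmt-QuantumFields-11685; helpers of the registered stub
`stub_transversePinch`, part 1 of 2)

Elementary facts used by the second line lead's back end ("transverse pinch"):

* growth pinches for `S₀ + S₁ cosh 4χ + S₂ cosh 8χ` (`top_nonneg`, `top_nonpos`, `mid_nonneg`,
  `mid_eq_zero`): the sign of the leading coefficient of a cosh-polynomial is read off at `χ → ∞`, and a
  leading coefficient is `≤ 0` as soon as the polynomial is `O(e^{rχ})` with `r` below its weight;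
* extraction of the coefficients of `b₀ + b₁ cos 4φ + b₂ cos 8φ` from three values, their uniqueness, and
  the continuity / evenness of the coefficient functions of a kernel continuous off the origin
  (`coeff_formula`, `trig_unique`, `coeff_continuous`, `coeff_even`);

(Part 2, `…TransversePinchChart`, has the box-integral and light-cone chart lemmas.)
All folklore; no definitions, no named facts.
-/

noncomputable section

namespace Summit.QuantumFields.YangMills.Cruxes.ShellRigidity.ThalesSlitExactConeType

open MeasureTheory Complex Real Filter Topology
open scoped InnerProductSpace BigOperators

local notation "E4" => EuclideanSpace ℝ (Fin 4)

namespace TransversePinch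


/-! ## Growth pinches for `S₀ + S₁ cosh 4χ + S₂ cosh 8χ` -/

/-- `cosh x ≤ exp x` for `x ≥ 0`. -/
theorem cosh_le_exp {x : ℝ} (hx : 0 ≤ x) : Real.cosh x ≤ Real.exp x := by
  rw [Real.cosh_eq]
  have : Real.exp (-x) ≤ Real.exp x := Real.exp_le_exp.2 (by linarith)
  linarith

/-- `exp x / 2 ≤ cosh x`. -/
theorem half_exp_le_cosh (x : ℝ) : Real.exp x / 2 ≤ Real.cosh x := by
  rw [Real.cosh_eq]
  have : 0 < Real.exp (-x) := Real.exp_pos _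
  linarith

/-- `1 ≤ cosh x`. -/
theorem one_le_cosh' (x : ℝ) : 1 ≤ Real.cosh x := Real.one_le_cosh x

/-- `c · exp(-k χ) → 0` as `χ → ∞` for `k > 0`. -/
theorem tendsto_const_mul_exp_neg {k : ℝ} (hk : 0 < k) (c : ℝ) :
    Tendsto (fun χ : ℝ => c * Real.exp (-(k * χ))) atTop (𝓝 0) := by
  have h := (Real.tendsto_exp_neg_atTop_nhds_zero.comp (tendsto_id.const_mul_atTop hk)).const_mul c
  simpa using h

/-- **Leading coefficient from below.** If `S₀ + S₁ cosh 4χ + S₂ cosh 8χ ≥ 0` for all `χ ≥ 0`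
then `S₂ ≥ 0`. -/
theorem top_nonneg {S₀ S₁ S₂ : ℝ}
    (h : ∀ χ : ℝ, 0 ≤ χ → 0 ≤ S₀ + S₁ * Real.cosh (4 * χ) + S₂ * Real.cosh (8 * χ)) : 0 ≤ S₂ := by
  by_contra hneg
  push Not at hneg
  -- `-S₂/2 ≤ |S₀| e^{-8χ} + |S₁| e^{-4χ}` for all `χ ≥ 0`
  have key : ∀ χ : ℝ, 0 ≤ χ →
      -S₂ / 2 ≤ |S₀| * Real.exp (-(8 * χ)) + |S₁| * Real.exp (-(4 * χ)) := by
    intro χ hχ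
    have h1 := h χ hχ
    have hc8 : Real.exp (8 * χ) / 2 ≤ Real.cosh (8 * χ) := half_exp_le_cosh _
    have hc4 : Real.cosh (4 * χ) ≤ Real.exp (4 * χ) := cosh_le_exp (by linarith)
    have hc4' : 0 ≤ Real.cosh (4 * χ) := le_trans zero_le_one (Real.one_le_cosh _)
    have e8 : Real.exp (8 * χ) * Real.exp (-(8 * χ)) = 1 := by rw [← Real.exp_add]; simp
    have hp8 : 0 < Real.exp (-(8 * χ)) := Real.exp_pos _
    -- from h1: -S₂ cosh(8χ) ≤ S₀ + S₁ cosh(4χ) ≤ |S₀| + |S₁| exp(4χ)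
    have h2 : -S₂ * (Real.exp (8 * χ) / 2) ≤ |S₀| + |S₁| * Real.exp (4 * χ) := by
      have : S₁ * Real.cosh (4 * χ) ≤ |S₁| * Real.exp (4 * χ) :=
        (le_abs_self _).trans (by rw [abs_mul, abs_of_nonneg hc4']; gcongr)
      nlinarith [le_abs_self S₀]
    -- multiply by exp(-8χ)
    have h3 := mul_le_mul_of_nonneg_right h2 hp8.le
    have e48 : Real.exp (4 * χ) * Real.exp (-(8 * χ)) = Real.exp (-(4 * χ)) := by
      rw [← Real.exp_add]; ring_nf
    have lhs : -S₂ * (Real.exp (8 * χ) / 2) * Real.exp (-(8 * χ)) = -S₂ / 2 := by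
      rw [show -S₂ * (Real.exp (8 * χ) / 2) * Real.exp (-(8 * χ)) =
        -S₂ / 2 * (Real.exp (8 * χ) * Real.exp (-(8 * χ))) by ring, e8, mul_one]
    have rhs : (|S₀| + |S₁| * Real.exp (4 * χ)) * Real.exp (-(8 * χ)) =
        |S₀| * Real.exp (-(8 * χ)) + |S₁| * Real.exp (-(4 * χ)) := by
      rw [← e48]; ring
    rw [lhs, rhs] at h3
    exact h3
  have hlim : Tendsto (fun χ : ℝ => |S₀| * Real.exp (-(8 * χ)) + |S₁| * Real.exp (-(4 * χ)))
      atTop (𝓝 0) := by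
    simpa using (tendsto_const_mul_exp_neg (by norm_num : (0:ℝ) < 8) |S₀|).add
      (tendsto_const_mul_exp_neg (by norm_num : (0:ℝ) < 4) |S₁|)
  have := ge_of_tendsto hlim (eventually_atTop.2 ⟨0, key⟩)
  linarith

/-- **Leading coefficient from above.** If `S₀ + S₁ cosh 4χ + S₂ cosh 8χ ≤ A (1 + e^{rχ})` for all
`χ ≥ 0` with `r < 8`, then `S₂ ≤ 0`. -/
theorem top_nonpos {S₀ S₁ S₂ A r : ℝ} (hr : r < 8)
    (h : ∀ χ : ℝ, 0 ≤ χ →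
      S₀ + S₁ * Real.cosh (4 * χ) + S₂ * Real.cosh (8 * χ) ≤ A * (1 + Real.exp (r * χ))) :
    S₂ ≤ 0 := by
  by_contra hpos
  push Not at hpos
  have key : ∀ χ : ℝ, 0 ≤ χ → S₂ / 2 ≤ |A| * Real.exp (-(8 * χ)) + |A| * Real.exp (-((8 - r) * χ)) +
      |S₀| * Real.exp (-(8 * χ)) + |S₁| * Real.exp (-(4 * χ)) := by
    intro χ hχ
    have h1 := h χ hχ
    have hc8 : Real.exp (8 * χ) / 2 ≤ Real.cosh (8 * χ) := half_exp_le_cosh _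
    have hc4 : Real.cosh (4 * χ) ≤ Real.exp (4 * χ) := cosh_le_exp (by linarith)
    have hc4' : 0 ≤ Real.cosh (4 * χ) := le_trans zero_le_one (Real.one_le_cosh _)
    have e8 : Real.exp (8 * χ) * Real.exp (-(8 * χ)) = 1 := by rw [← Real.exp_add]; simp
    have er : Real.exp (r * χ) * Real.exp (-(8 * χ)) = Real.exp (-((8 - r) * χ)) := by
      rw [← Real.exp_add]; ring_nf
    have hp8 : 0 < Real.exp (-(8 * χ)) := Real.exp_pos _
    have h2 : S₂ * (Real.exp (8 * χ) / 2) ≤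
        |A| * (1 + Real.exp (r * χ)) + |S₀| + |S₁| * Real.exp (4 * χ) := by
      have i1 : S₁ * Real.cosh (4 * χ) ≥ -(|S₁| * Real.exp (4 * χ)) := by
        have : |S₁ * Real.cosh (4 * χ)| ≤ |S₁| * Real.exp (4 * χ) := by
          rw [abs_mul, abs_of_nonneg hc4']; gcongr
        linarith [neg_abs_le (S₁ * Real.cosh (4 * χ))]
      have i2 : A * (1 + Real.exp (r * χ)) ≤ |A| * (1 + Real.exp (r * χ)) := by
        have : 0 ≤ 1 + Real.exp (r * χ) := by positivity
        exact mul_le_mul_of_nonneg_right (le_abs_self A) this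
      nlinarith [neg_abs_le S₀, le_abs_self S₀]
    have h3 := mul_le_mul_of_nonneg_right h2 hp8.le
    have e48 : Real.exp (4 * χ) * Real.exp (-(8 * χ)) = Real.exp (-(4 * χ)) := by
      rw [← Real.exp_add]; ring_nf
    have lhs : S₂ * (Real.exp (8 * χ) / 2) * Real.exp (-(8 * χ)) = S₂ / 2 := by
      rw [show S₂ * (Real.exp (8 * χ) / 2) * Real.exp (-(8 * χ)) =
        S₂ / 2 * (Real.exp (8 * χ) * Real.exp (-(8 * χ))) by ring, e8, mul_one]
    have rhs : (|A| * (1 + Real.exp (r * χ)) + |S₀| + |S₁| * Real.exp (4 * χ)) * Real.exp (-(8 * χ)) =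
        |A| * Real.exp (-(8 * χ)) + |A| * Real.exp (-((8 - r) * χ)) +
          |S₀| * Real.exp (-(8 * χ)) + |S₁| * Real.exp (-(4 * χ)) := by
      rw [← e48, ← er]; ring
    rw [lhs, rhs] at h3
    exact h3
  have hlim : Tendsto (fun χ : ℝ => |A| * Real.exp (-(8 * χ)) + |A| * Real.exp (-((8 - r) * χ)) +
      |S₀| * Real.exp (-(8 * χ)) + |S₁| * Real.exp (-(4 * χ))) atTop (𝓝 0) := by
    have h8r : (0:ℝ) < 8 - r := by linarith
    simpa using (((tendsto_const_mul_exp_neg (by norm_num : (0:ℝ) < 8) |A|).add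
      (tendsto_const_mul_exp_neg h8r |A|)).add
      (tendsto_const_mul_exp_neg (by norm_num : (0:ℝ) < 8) |S₀|)).add
      (tendsto_const_mul_exp_neg (by norm_num : (0:ℝ) < 4) |S₁|)
  have := ge_of_tendsto hlim (eventually_atTop.2 ⟨0, key⟩)
  linarith

/-- **Middle coefficient from below** (no top term). If `S₀ + S₁ cosh 4χ ≥ 0` for all `χ ≥ 0` then
`S₁ ≥ 0`. -/
theorem mid_nonneg {S₀ S₁ : ℝ} (h : ∀ χ : ℝ, 0 ≤ χ → 0 ≤ S₀ + S₁ * Real.cosh (4 * χ)) : 0 ≤ S₁ := by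
  have := top_nonneg (S₀ := S₀) (S₁ := 0) (S₂ := S₁) fun χ hχ => by
    have h1 := h (2 * χ) (by linarith)
    rw [show 4 * (2 * χ) = 8 * χ by ring] at h1
    simpa using h1
  exact this

/-- **Middle coefficient pinched from both sides.** If `|S₁| cosh 4χ ≤ S₀` for all `χ ≥ 0` then
`S₁ = 0`. -/
theorem mid_eq_zero {S₀ S₁ : ℝ} (h : ∀ χ : ℝ, 0 ≤ χ → |S₁| * Real.cosh (4 * χ) ≤ S₀) : S₁ = 0 := by
  by_contra hne
  have hpos : 0 < |S₁| := abs_pos.2 hne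
  -- `cosh (4χ) ≤ S₀/|S₁|` for all `χ ≥ 0`, impossible since `cosh (4χ) ≥ exp(4χ)/2 → ∞`
  have key : ∀ χ : ℝ, 0 ≤ χ → Real.exp (4 * χ) / 2 ≤ S₀ / |S₁| := by
    intro χ hχ
    rw [le_div_iff₀ hpos]
    have := h χ hχ
    have := half_exp_le_cosh (4 * χ)
    nlinarith
  have hlim : Tendsto (fun χ : ℝ => Real.exp (4 * χ) / 2) atTop atTop :=
    (Real.tendsto_exp_atTop.comp (tendsto_id.const_mul_atTop (by norm_num : (0:ℝ) < 4))).atTop_div_const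
      (by norm_num)
  have hev := hlim.eventually_gt_atTop (S₀ / |S₁|)
  obtain ⟨χ, hχ⟩ := (hev.and (eventually_ge_atTop 0)).exists
  linarith [key χ hχ.2, hχ.1]

/-! ## Coefficient extraction from the trigonometric identity -/

/-- The three coefficients of `b₀ + b₁ cos 4φ + b₂ cos 8φ` from the values at `φ = 0, π/8, π/4`. -/
theorem coeff_formula {g : ℝ → ℝ} {b₀ b₁ b₂ : ℝ}
    (h : ∀ φ : ℝ, g φ = b₀ + b₁ * Real.cos (4 * φ) + b₂ * Real.cos (8 * φ)) :
    b₀ = ((g 0 + g (π / 4)) / 2 + g (π / 8)) / 2 ∧ b₁ = (g 0 - g (π / 4)) / 2 ∧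
      b₂ = ((g 0 + g (π / 4)) / 2 - g (π / 8)) / 2 := by
  have h0 := h 0
  have h1 := h (π / 8)
  have h2 := h (π / 4)
  have e1 : Real.cos (4 * (π / 8)) = 0 := by
    rw [show 4 * (π / 8) = π / 2 by ring]; exact Real.cos_pi_div_two
  have e2 : Real.cos (8 * (π / 8)) = -1 := by rw [show 8 * (π / 8) = π by ring]; exact Real.cos_pi
  have e3 : Real.cos (4 * (π / 4)) = -1 := by rw [show 4 * (π / 4) = π by ring]; exact Real.cos_pi
  have e4 : Real.cos (8 * (π / 4)) = 1 := by
    rw [show 8 * (π / 4) = (2 : ℕ) * π by push_cast; ring]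
    exact (Real.cos_nat_mul_pi 2).trans (by norm_num)
  simp only [mul_zero, Real.cos_zero, mul_one] at h0
  rw [e1, e2] at h1
  rw [e3, e4] at h2
  refine ⟨by linarith, by linarith, by linarith⟩


/-- Uniqueness of the coefficients of `1, cos 4φ, cos 8φ`. -/
theorem trig_unique {a₀ a₁ a₂ c₀ c₁ c₂ : ℝ}
    (h : ∀ φ : ℝ, a₀ + a₁ * Real.cos (4 * φ) + a₂ * Real.cos (8 * φ) =
      c₀ + c₁ * Real.cos (4 * φ) + c₂ * Real.cos (8 * φ)) :
    a₀ = c₀ ∧ a₁ = c₁ ∧ a₂ = c₂ := by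
  obtain ⟨h0, h1, h2⟩ := coeff_formula (g := fun φ => a₀ + a₁ * Real.cos (4 * φ) + a₂ * Real.cos (8 * φ))
    (b₀ := c₀) (b₁ := c₁) (b₂ := c₂) h
  obtain ⟨k0, k1, k2⟩ := coeff_formula (g := fun φ => a₀ + a₁ * Real.cos (4 * φ) + a₂ * Real.cos (8 * φ))
    (b₀ := a₀) (b₁ := a₁) (b₂ := a₂) fun _ => rfl
  exact ⟨k0.trans h0.symm, k1.trans h1.symm, k2.trans h2.symm⟩

/-- A planar point of a vector of `ℝ⁴` with nonzero `(x₀,x₁)` is not the origin. -/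
theorem mk4_ne_zero {p q : ℝ} (h : p ≠ 0 ∨ q ≠ 0) (y z : ℝ) :
    (WithLp.toLp 2 ![p, q, y, z] : E4) ≠ 0 := by
  intro h0
  have h1 := congrArg (fun v : E4 => v 0) h0
  have h2 := congrArg (fun v : E4 => v 1) h0
  simp at h1 h2
  rcases h with h | h
  · exact h h1
  · exact h h2

/-- The transverse trace `ζ ↦ K(p, q, ζ₁, ζ₂)` of a kernel continuous off the origin is continuous when
`(p,q) ≠ 0`. -/
theorem continuous_transverse {K : E4 → ℝ} (hcont : ContinuousOn K {x : E4 | x ≠ 0}) {p q : ℝ}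
    (h : p ≠ 0 ∨ q ≠ 0) : Continuous fun ζ : ℝ × ℝ => K (WithLp.toLp 2 ![p, q, ζ.1, ζ.2]) := by
  have hφ : Continuous fun ζ : ℝ × ℝ => (WithLp.toLp 2 ![p, q, ζ.1, ζ.2] : E4) := by
    refine (PiLp.continuous_toLp 2 _).comp (continuous_pi fun i => ?_)
    fin_cases i <;> simp <;> fun_prop
  exact hcont.comp_continuous hφ fun ζ => mk4_ne_zero h ζ.1 ζ.2

/-- `cos φ` and `sin φ` do not vanish simultaneously, scaled by `t ≠ 0`. -/
theorem cos_or_sin_ne_zero {t : ℝ} (ht : t ≠ 0) (φ : ℝ) : t * Real.cos φ ≠ 0 ∨ t * Real.sin φ ≠ 0 := by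
  by_contra h
  push Not at h
  have h1 : Real.cos φ = 0 := by simpa [ht] using h.1
  have h2 : Real.sin φ = 0 := by simpa [ht] using h.2
  have := Real.sin_sq_add_cos_sq φ
  rw [h1, h2] at this
  norm_num at this

/-- **Continuity of the coefficient functions.** If the angular trace of `K` along the circle
`φ ↦ (t cos(φ-θ), t sin(φ-θ))`, `t ≠ 0`, is `b₀(ζ) + b₁(ζ) cos 4φ + b₂(ζ) cos 8φ` at every transverse
offset `ζ`, then each `b_j` is a continuous function of `ζ` (it is a finite combination of three
transverse traces of `K`). -/
theorem coeff_continuous {K : E4 → ℝ} (hcont : ContinuousOn K {x : E4 | x ≠ 0}) {t θ : ℝ} (ht : t ≠ 0)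
    {c₀ c₁ c₂ : ℝ × ℝ → ℝ}
    (h : ∀ (ζ : ℝ × ℝ) (φ : ℝ), K (WithLp.toLp 2 ![t * Real.cos (φ - θ), t * Real.sin (φ - θ), ζ.1, ζ.2]) =
      c₀ ζ + c₁ ζ * Real.cos (4 * φ) + c₂ ζ * Real.cos (8 * φ)) :
    Continuous c₀ ∧ Continuous c₁ ∧ Continuous c₂ := by
  have key := fun ζ : ℝ × ℝ => coeff_formula (h ζ)
  have hg : ∀ φ : ℝ, Continuous fun ζ : ℝ × ℝ =>
      K (WithLp.toLp 2 ![t * Real.cos (φ - θ), t * Real.sin (φ - θ), ζ.1, ζ.2]) :=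
    fun φ => continuous_transverse hcont (cos_or_sin_ne_zero ht _)
  refine ⟨?_, ?_, ?_⟩
  · have : c₀ = fun ζ => ((K (WithLp.toLp 2 ![t * Real.cos (0 - θ), t * Real.sin (0 - θ), ζ.1, ζ.2]) +
        K (WithLp.toLp 2 ![t * Real.cos (π / 4 - θ), t * Real.sin (π / 4 - θ), ζ.1, ζ.2])) / 2 +
        K (WithLp.toLp 2 ![t * Real.cos (π / 8 - θ), t * Real.sin (π / 8 - θ), ζ.1, ζ.2])) / 2 :=
      funext fun ζ => (key ζ).1
    rw [this]
    exact (((hg 0).add (hg _)).div_const _ |>.add (hg _)).div_const _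
  · have : c₁ = fun ζ => (K (WithLp.toLp 2 ![t * Real.cos (0 - θ), t * Real.sin (0 - θ), ζ.1, ζ.2]) -
        K (WithLp.toLp 2 ![t * Real.cos (π / 4 - θ), t * Real.sin (π / 4 - θ), ζ.1, ζ.2])) / 2 :=
      funext fun ζ => (key ζ).2.1
    rw [this]
    exact ((hg 0).sub (hg _)).div_const _
  · have : c₂ = fun ζ => ((K (WithLp.toLp 2 ![t * Real.cos (0 - θ), t * Real.sin (0 - θ), ζ.1, ζ.2]) +
        K (WithLp.toLp 2 ![t * Real.cos (π / 4 - θ), t * Real.sin (π / 4 - θ), ζ.1, ζ.2])) / 2 -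
        K (WithLp.toLp 2 ![t * Real.cos (π / 8 - θ), t * Real.sin (π / 8 - θ), ζ.1, ζ.2])) / 2 :=
      funext fun ζ => (key ζ).2.2
    rw [this]
    exact (((hg 0).add (hg _)).div_const _ |>.sub (hg _)).div_const _

/-- **Evenness of the coefficient functions** in the transverse variable, from the evenness of `K` in
`(x₂, x₃)`. -/
theorem coeff_even {K : E4 → ℝ} (hflip23 : ∀ x : E4, K (WithLp.toLp 2 ![x 0, x 1, -x 2, -x 3]) = K x)
    {t θ : ℝ} {c₀ c₁ c₂ : ℝ × ℝ → ℝ}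
    (h : ∀ (ζ : ℝ × ℝ) (φ : ℝ), K (WithLp.toLp 2 ![t * Real.cos (φ - θ), t * Real.sin (φ - θ), ζ.1, ζ.2]) =
      c₀ ζ + c₁ ζ * Real.cos (4 * φ) + c₂ ζ * Real.cos (8 * φ)) (ζ : ℝ × ℝ) :
    c₀ (-ζ) = c₀ ζ ∧ c₁ (-ζ) = c₁ ζ ∧ c₂ (-ζ) = c₂ ζ := by
  refine trig_unique fun φ => ?_
  rw [← h (-ζ) φ, ← h ζ φ, ← hflip23 (WithLp.toLp 2 ![t * Real.cos (φ - θ), t * Real.sin (φ - θ), ζ.1, ζ.2])]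
  simp


end TransversePinch

end Summit.QuantumFields.YangMills.Cruxes.ShellRigidity.ThalesSlitExactConeType
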